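import Mathlib
import HarnessLib
import HarnessLib.Audit
import Summits.CriticalPhenomena.Statement
import Literature.Probability.RandomPlanarGeometry.YangBaxterSAWLaw
import HarnessLib.Audit.Status.Attr

/-!
Route: SAWCompassLattice

DORMANT since 2026-08-25T14:02:29Z (reconciler: no traction for 7.8 d (last activity item-evidence-added at 2026-08-17T19:16:32Z); parked, not closed — `ledger route dormant route-CriticalPhenomena-SAWCompassLattice --off` to reactivate) — unstaffed, not closed; items shared with open routes are served there. `ledger route dormant <id> --off` reactivates.

# Route SAWCompassLattice — the compass lattice — an honest D4-symmetric SAW that IS the integrable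
n=0 point of Z²; SLE there, then universality along one lattice's critical surface

It suffices to show X = (R) ∧ (E) ∧ (Σ) ∧ (U), realising idea card compass-lattice-integrable-saw
(spine, sole card):
(R) CompassRealisation — positive edge fugacities (α, β, s, z) exist at which the COMPASS GADGET
(outer 8-cycle Q₀A₀Q₁A₁Q₂A₂Q₃A₃ of fugacity α, spokes A_kI_k of fugacity s, inner 4-cycle I₀I₁I₂I₃
of fugacity β, terminal Q_k joined to the port on side k of its face by an edge of fugacity z) has
terminal generating functions hitting Glazman–Manolescu's θ = π/2 Yang–Baxter face weights EXACTLY: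
z²T_adj = u₁(π/2), z²T_opp = v(π/2), z⁴D = w₁(π/2);
(E) CompassEndpoints — every Dobrushin domain admits port (mid-edge) endpoint approximations on the
square tiling;
(Σ) CompassSLE — for every such fugacity vector the honest multi-fugacity self-avoiding walk on the
compass lattice Γ* (vertices = ports `MidEdge` ⊔ `Face × Fin 3 × Fin 4`, one gadget per face of
`meshFaces (π/2) Ω δ`), from port a_δ to port b_δ, pushed to `CurveClass ℂ`, converges in law to
chordal SLE_(8/3);
(U) SurfaceUniversality — that compass chordal law and the critical uniform ℤ² law
`Literature.Probability.RandomPlanarGeometry.SAW.law` become asymptotically equal on bounded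
continuous test functions as δ → 0+.
Then `SAWScalingLimit` follows by the two-ε argument (item Assembly; proved sorry-free in the
planner's Sketch.lean, axioms propext/Classical.choice/Quot.sound). The typed X below is the ∃-form
(one fugacity vector serving (Σ) and (U)); the items quantify (Σ), (U) over all solutions of (R).
Lean: `open Literature.Probability.RandomPlanarGeometry.SAW.YangBaxter
Literature.Probability.RandomPlanarGeometry in ∃ α β s z : ℝ, (0 < α ∧ 0 < β ∧ 0 < s ∧ 0 < z ∧ z ^ 2
* (α ^ 2 + α ^ 6 + s ^ 2 * (2 * α ^ 2 * β + 2 * α ^ 2 * β ^ 2 + 2 * α ^ 2 * β ^ 3 + 2 * α ^ 4 * β +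
4 * α ^ 4 * β ^ 2 + 2 * α ^ 4 * β ^ 3 + 2 * α ^ 6 * β + 2 * α ^ 6 * β ^ 3) + 2 * s ^ 4 * α ^ 4 * β ^
2) = weightU1 (Real.pi / 2) ∧ z ^ 2 * (2 * α ^ 4 + s ^ 2 * (2 * α ^ 2 * β + 4 * α ^ 2 * β ^ 2 + 2 *
α ^ 2 * β ^ 3 + 4 * α ^ 4 * β + 4 * α ^ 4 * β ^ 3 + 4 * α ^ 6 * β ^ 2) + 2 * s ^ 4 * α ^ 4 * β ^ 2)
= weightV (Real.pi / 2) ∧ z ^ 4 * (α ^ 4 + s ^ 2 * (4 * α ^ 4 * β + 4 * α ^ 4 * β ^ 2 + 4 * α ^ 4 *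
β ^ 3) + 2 * s ^ 4 * α ^ 4 * β ^ 2) = weightW1 (Real.pi / 2)) ∧ (let cyc : Fin 4 → Side := ![Side.W,
Side.N, Side.E, Side.S]; let R : (MidEdge ⊕ Face × Fin 3 × Fin 4) → (MidEdge ⊕ Face × Fin 3 × Fin 4)
→ Prop := fun x x' => (match x, x' with | Sum.inl e, Sum.inr (f, (l, i)) => l = 0 ∧ f.side (cyc i) =
e | Sum.inr (f, (l, i)), Sum.inr (f', (l', i')) => f = f' ∧ ((l = 0 ∧ l' = 1 ∧ (i' = i ∨ i' + 1 =
i)) ∨ (l = 1 ∧ l' = 2 ∧ i' = i) ∨ (l = 2 ∧ l' = 2 ∧ i' = i + 1)) | _, _ => False); let G :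
SimpleGraph (MidEdge ⊕ Face × Fin 3 × Fin 4) := SimpleGraph.fromRel R; let y : (MidEdge ⊕ Face × Fin
3 × Fin 4) → (MidEdge ⊕ Face × Fin 3 × Fin 4) → ℝ := fun x x' => (match x, x' with | Sum.inl _,
Sum.inr _ => z | Sum.inr _, Sum.inl _ => z | Sum.inr (_, (l, _)), Sum.inr (_, (l', _)) => if l = 0 ∨
l' = 0 then α else if l = 1 ∨ l' = 1 then s else β | _, _ => 0); let wt : ∀ {u v : (MidEdge ⊕ Face ×
Fin 3 × Fin 4)}, G.Walk u v → ℝ := fun p => (p.darts.map fun d => y d.fst d.snd).prod; let dir : Fin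
4 → ℂ := ![-1, Complex.I, 1, -Complex.I]; let emb : (MidEdge ⊕ Face × Fin 3 × Fin 4) → ℂ := fun x =>
(match x with | Sum.inl e => planeMidpoint (fun (_ : ℤ) => Real.pi / 2) e | Sum.inr (f, (l, i)) =>
planeCorner (fun (_ : ℤ) => Real.pi / 2) f + (1 + Complex.I) / 2 + (if l = 0 then (3 / 8 : ℂ) * dir
i else (if l = 1 then (1 / 4 : ℂ) else (1 / 8 : ℂ)) * (dir i + dir (i + 1)))); let S : Set ℂ → ℝ →
Set (MidEdge ⊕ Face × Fin 3 × Fin 4) := fun Ω δ => {v | ∀ f q, v = Sum.inr (f, q) → f ∈ meshFaces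
(fun (_ : ℤ) => Real.pi / 2) Ω δ}; let μ : Set ℂ → ℝ → MidEdge → MidEdge → Measure (CurveClass ℂ) :=
fun Ω δ a b => Measure.sum (fun p : {p : G.Walk (Sum.inl a) (Sum.inl b) // p.IsPath ∧ ∀ v ∈
p.support, v ∈ S Ω δ} => ENNReal.ofReal (wt p.1) • Measure.dirac (CurveClass.mk ⟨p.1.toCurve fun v
=> (δ : ℂ) * emb v⟩)); let law : Set ℂ → ℝ → MidEdge → MidEdge → Measure (CurveClass ℂ) := fun Ω δ a
b => (μ Ω δ a b Set.univ)⁻¹ • μ Ω δ a b; (∀ D : DobrushinDomain, ∃ a b : ℝ → MidEdge,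
IsYBEndpointApprox (fun (_ : ℤ) => Real.pi / 2) D a b) ∧ (∀ (D : DobrushinDomain) (a b : ℝ →
MidEdge), IsYBEndpointApprox (fun (_ : ℤ) => Real.pi / 2) D a b → ConvergesInLawToSLE ((8 : NNReal)
/ 3) D (fun (_ : ℝ) (x : CurveClass ℂ) => x) (fun δ => law D.carrier δ (a δ) (b δ))) ∧ (∀ (D :
DobrushinDomain) (a b : ℝ → Literature.Probability.LatticeModels.Site 2) (a' b' : ℝ → MidEdge),
SAW.IsEndpointApprox D a b → IsYBEndpointApprox (fun (_ : ℤ) => Real.pi / 2) D a' b' → ∀ f :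
BoundedContinuousFunction (CurveClass ℂ) ℝ, Filter.Tendsto (fun δ => (∫ γ, f γ.curve ∂(SAW.law
D.carrier δ (a δ) (b δ))) - ∫ x, f x ∂(law D.carrier δ (a' δ) (b' δ))) (nhdsWithin 0 (Set.Ioi 0))
(nhds 0)))`

## Assembly
Pure logic plus limit algebra, PROVED sorry-free in the planner's Sketch.lean
(`assembly_pure_logic`, and `thesisX_suffices : ThesisX → SAWScalingLimit`, `items_give_thesisX`):
fix a Dobrushin domain D and a ℤ² endpoint approximation (a, b); take (α,β,s,z) from
CompassRealisation and ports (a', b') from CompassEndpoints; CompassSLE yields an SLE_(8/3) random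
curve Γ with ∫ f d(compass law)_δ → E f(Γ) for every bounded continuous f; SurfaceUniversality gives
∫ f∘curve dP^(ℤ²)_δ − ∫ f d(compass law)_δ → 0; adding the two limits gives `TendstoLaw` for the ℤ²
law; a.e.-measurability is `SAW.aemeasurable_curve`; hence `ConvergesInLawToSLE (8/3)`, i.e.
`SAWScalingLimit`.

Rationale: WHY THIS LINE. Mechanism (card compass-lattice-integrable-saw): PORT GADGETS turn
Glazman–Manolescu's Yang–Baxter face-walk on the square tiling at θ = π/2 — the Nienhuis /
Ikhlef–Cardy integrable n = 0 point of the square lattice (GlazmanManolescu2019 eq. (1);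
Glazman2015WeightedSAW (1.1)–(1.5); IkhlefCardy2009 §3), which "can traverse the same face twice"
and is not a self-avoiding walk — into an HONEST self-avoiding walk with positive edge fugacities on
a ℤ²-periodic planar lattice with the full symmetry group of ℤ² (translations, both axis
reflections, quarter-turn): a degree-2 port on every edge forces one crossing per edge, planarity of
the gadget makes the crossing pairing unrealizable, and summing internal routes converts edge
fugacities into face weights (1, z²T_adj, z²T_opp, z⁴D); the compass gadget hits (u₁, v, w₁)(π/2) =
(0.408390934, 0.320870698, 0.112674805) exactly on a one-parameter algebraic family (planner
re-derived the three polynomials by two independent enumerations and re-solved: s = 1 gives α =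
0.176073479, β = 0.442080830, z = 2.286842805; the plain 4-cycle decoration misses by 1.5 %), so by
transport Γ* is exactly critical (Glazman2015WeightedSAW Thm 1.1), has the honeycomb's boundary
two-point function and vanishing bridges (GlazmanManolescu2019 Thms 1–2) and y_c = 1 + √2 (Thm 3,
BeatonBousquetMelouDeGierDuminilCopinGuttmann2014).
Imported areas: integrable lattice models (Yang–Baxter weights = discrete half-holomorphicity,
Nienhuis1982, IkhlefCardy2009, DuminilCopin2013Parafermion §12.5) for the solvable endpoint;
planar-gadget weight engineering, the technique of the #P-hardness reductions catalogued in
Literature.Barriers.CriticalPhenomena.GridSAWCounting*, used constructively; weighted / locality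
theory of SAW on quasi-transitive graphs (GrimmettLi2019 = doi:10.1007/s10801-019-00895-6,
GrimmettLi2013 = doi:10.37236/2659 Fisher transformation) and the exponential-family
fluctuation–response calculus of the sibling cards honeycomb-inside-z2-weight-homotopy /
quadrupole-ward-two-bodies for the universality step.
What is new versus route SAWHexUniversality (whose r4 YBtoUniform compares GM's self-touching
face-walk with the uniform walk, with no mechanism, and whose r2 compares two lattices with
incompatible symmetry groups): here ℤ² itself is the 'plus' gadget (one centre vertex joined to the
four ports, fugacity √x_c) on the SAME port scaffold, so the integrable walk and the uniform walk
are two points of the critical surface of ONE ℤ²-periodic D4-symmetric lattice Γ⁺ = compass ∪ plus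
with five fugacity classes; the universality step (U) becomes motion along that surface, where D4
pins Beffara's linear modulus at every point (Beffara2008Universal §1–2), every reweighting score is
D4-even hence has no spin-2 component (the decorrelation engine (Q1) of card
quadrupole-ward-two-bodies), and honest-SAW tools — sub-multiplicativity, Hammersley–Welsh
unfolding, Kesten's pattern theorem, bridge decompositions, Duminil-Copin–Hammond surgery
(MadrasSlade1993, Kesten1963SAW, DuminilCopinHammond2013) — apply to both ends and along the path;
none applies to GM's face-walk. The provable core (R) + PortDictionary comes first and is decisive
either way; no probabilistic reformulation beyond the model itself, no spectral or motivic lift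
(none touches lattice universality).

RANKED CRUXES. #2 CompassRealisation (crux) — (card r4, the construction; ranked first as the gating
fact of the mechanism, plancard rule) there exist reals α, β, s, z > 0 with z²·T_adj(α,β,s) =
weightU1(π/2), z²·T_opp(α,β,s) = weightV(π/2) and z⁴·D(α,β,s) = weightW1(π/2), where T_adj / T_opp
are the generating polynomials of the 22 / 24 simple routes between adjacent / opposite terminals of
the compass gadget (routes through the other terminals included) and D that of the 15
vertex-disjoint pairs of adjacent routes — the explicit integer polynomials written in the Lean term
(α enters only through α², s only through s², and T_adj, T_opp are quadratic in s² with the SAME top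
coefficient 2α⁴β², so T_opp·u₁ = T_adj·v is solvable for s² in radicals and one 1-D
intermediate-value argument in α at fixed β finishes; numerically s = 1: α = 0.176073479, β =
0.442080830, z = 2.286842805; α = β = 0.146690793: s = 2.448064821, z = 2.459167475). [difficulty:
provable-now] (why it might fail: the exact positive solution is certified only in floating point
(Newton at two family members); an ill-conditioned or spurious root, or a solution family leaving
the positive orthant, kills Γ* — the plain 4-cycle decoration provably misses the target by 1.5 %.)
[GlazmanManolescu2019, Glazman2015WeightedSAW, IkhlefCardy2009, doi:10.1088/0305-4470/31/40/008]
#3 SurfaceUniversality (crux) — (card r2, hardest, the new mathematics) for every solution (α,β,s,z)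
of the compass equations, every Dobrushin domain (Ω;a,b), every ℤ² endpoint approximation (a_δ,b_δ)
(`SAW.IsEndpointApprox`) and every port endpoint approximation (a'_δ,b'_δ) (`IsYBEndpointApprox` at
Θ ≡ π/2), and every bounded continuous f on `CurveClass ℂ`: ∫ f∘curve dP^(ℤ²)_(x_c,δ) − ∫ f
d(compass chordal law)_δ → 0 as δ → 0+. Intended mechanism (informal; the foreseen split): both laws
are honest SAW laws on ONE lattice Γ⁺ = compass ∪ plus (ℤ² = plus gadget of fugacity √x_c on the
same ports); follow a path t ↦ y(t) in the critical surface of Γ⁺ from (α,β,s,z;0) to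
(0,0,0,0;√x_c): D4 at every t (no linear modulus), D4-even scores (no spin-2 response),
locality/continuity of weighted SAW at the two orthant faces (Grimmett–Li), dilute phase throughout
(checkable by transfer matrices). [deps: CompassRealisation] [difficulty: XL] (why it might fail: no
tool yet proves irrelevance of a D4-symmetric local reweighting at a non-Gaussian fixed point; a
collapse-type transition on the path driven by the osculation weight w (BN-point / VISAW phase
diagram) would separate the two points; typed form needs both limits to exist.)
[GlazmanManolescu2019, Beffara2008Universal, doi:10.1007/s10801-019-00895-6, KennedyLawler2013,
doi:10.1088/1751-8113/45/50/505003, MadrasSlade1993, Kesten1963SAW]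
#4 CompassSLE (crux) — (card r3) for every solution (α,β,s,z), every Dobrushin domain and every port
endpoint approximation (`IsYBEndpointApprox` at Θ ≡ π/2), the compass chordal law — edge-fugacity
self-avoiding paths of the compass graph on `MidEdge ⊕ (Face × (Fin 3 × Fin 4))` from port a_δ to
port b_δ using only gadgets of faces in `meshFaces (π/2) Ω δ`, weight = product of edge fugacities
(α outer cycle, β inner cycle, s spokes, z port–terminal), normalised, pushed to `CurveClass ℂ` by
the δ-scaled polyline through the embedded vertices — converges in law to chordal SLE_(8/3)
(`ConvergesInLawToSLE (8/3)`). Via PortDictionary and the deterministic O(δ) coupling (each gadget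
lies inside its face) this is exactly support item YBSquareSLE, i.e. Duminil-Copin–Smirnov
Conjecture 1 transported to GM's θ = π/2 walk — same status as on the honeycomb lattice, but on a
lattice sharing ℤ²'s axes, reflections and quarter-turn, where the spin-5/8 parafermion lives on the
ports. [deps: CompassRealisation, PortDictionary, YBSquareSLE] [difficulty: open-problem] (why it
might fail: it IS the hexagonal problem in square clothing: the port parafermion obeys only the
plaquette half of discrete Cauchy–Riemann (barrier ParafermionicHalfCauchyRiemann), no RSW/tightness
theory for SAW exists, and the extra D4 symmetry supplies no missing relation by itself.)
[DuminilCopinSmirnov2012, GlazmanManolescu2019, IkhlefCardy2009, LawlerSchrammWerner2004SAW,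
DuminilCopin2013Parafermion, DuminilCopinHammond2013]
#5 PortDictionary (crux) — (card r4, the dictionary; provable core) for every solution (α,β,s,z),
every set of faces Δ, ports a, b and every list ms of mid-edges: the total weight of the compass
self-avoiding paths from port a to port b that use only gadgets of faces in Δ and whose ordered
sequence of visited ports is ms EQUALS the Glazman–Manolescu weight w_(π/2)(γ) of the Yang–Baxter
walk γ of Δ with `mids = ms` (both sides 0 if there is none). Content: degree-2 ports ⇒ each edge
crossed at most once and consecutive passages lie in different faces (`isChain`); ≤ 2
vertex-disjoint passages per face; the crossing pairing {W,E}+{S,N} has no realisation in the planar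
gadget (`noncross`; 0 pairs by enumeration); summing internal routes face by face gives face weights
(1, z²T_adj, z²T_opp, z⁴D) = (1, u₁, v, w₁)(π/2), and u₂(π/2) = u₁(π/2), w₂(π/2) = w₁(π/2) (proved
in NienhuisWeightsExcludeVertexSAW). Corollaries by transport, not filed as items: compass
port-to-port partition functions = `twoPoint Δ (π/2)`, hence exact criticality (Glazman 2015 Thm
1.1), honeycomb-equal half-plane two-point function and B_T → 0 (GM Thms 1–2), y_c = 1+√2 (GM Thm
3). [difficulty: provable-now] (why it might fail: a bookkeeping mismatch with the tree's `YBWalk`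
conventions (boundary mid-edges whose outer face is not in Δ, `kindsIn` order, `arcFace` of repeated
faces) or an internal route class missed in T_adj/T_opp/D would falsify the identity exactly as
typed (repairable by restating).) [GlazmanManolescu2019,
Literature.Probability.RandomPlanarGeometry.SAW.YangBaxter.YBWalk,
Literature.Barriers.CriticalPhenomena.NienhuisWeightsExcludeVertexSAW,
Literature.Barriers.CriticalPhenomena.GridSAWCountingSharpPComplete]
#9 YBSquareSLE (support) — Glazman–Manolescu's critical Yang–Baxter walk on the square tiling (Θ ≡
π/2, fugacity x = 1: `ybLaw`, curve `YBWalk.curve`) converges to chordal SLE_(8/3) in every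
Dobrushin domain with port endpoint approximations — the clean interface with route
SAWHexUniversality (its HexConjecture + YBUniversalityOfLimit at Θ ≡ π/3 ↔ π/2 give it) and the
parent of the foreseen split CompassSLE ⇐ YBSquareSLE + PortDictionary-coupling. [difficulty:
open-problem] [GlazmanManolescu2019, DuminilCopinSmirnov2012, LawlerSchrammWerner2004SAW]
#9 CompassEndpoints (support) — every Dobrushin domain (bounded Jordan domain, two marked prime
ends) admits port endpoint approximations at Θ ≡ π/2: mid-edges a_δ, b_δ joined by a Yang–Baxter
walk through faces of `meshFaces (π/2) Ω δ`, with δ·a_δ → a and δ·b_δ → b (accessibility of boundary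
points of a Jordan domain + a chain of δ-faces along an interior path; diagonal choice in δ). Needed
only to make the Assembly pure logic. [difficulty: provable-now] [DuminilCopinSmirnov2012,
GlazmanManolescu2019]

TWO-LAYER PLAN. Foreseen glued splits (k ≤ 3, depth 1; nothing filed now): CompassSLE ⇐ YBSquareSLE
→ PortCoupling → CompassSLE, where PortCoupling = "under PortDictionary the compass curve and the GM
polyline through the same ports are, path by path, within Hausdorff–reparametrised distance 2δ, so
`ConvergesInLawToSLE` transfers" (provable now); YBSquareSLE ⇐ HexConjecture (route
SAWHexUniversality, shared decl) → YBAngleTransport(π/3 ↔ π/2, curve-law upgrade of GM Thm 1) →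
YBSquareSLE; SurfaceUniversality ⇐ PlusPointIsZ2 (the Γ⁺ law at (0,0,0,0;√x_c) between vert-ports is
`SAW.law` with each ℤ² edge split at its port; provable now) → SurfaceTransport (subsequential
limits constant along a D4-symmetric path in the dilute critical surface of Γ⁺: decorrelation of
D4-even scores, the (Q1) engine) → EndpointLocality (continuity of x_c and of limits at the two
orthant faces, Grimmett–Li weighted/locality theory) → SurfaceUniversality; CompassRealisation may
split as Polynomials (the three enumerations, by `decide`-style reflection) → RootCertificate
(interval arithmetic / IVT).

KILL CRITERIA. ¬CompassRealisation (no exact positive solution) closes the route outright (`close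
--reason refuted:CompassRealisation`): without exactness Γ* is just another non-integrable lattice
and nothing transports. ¬PortDictionary as typed forces a restate (bookkeeping), but a GENUINE extra
passage type (a compass path realising a face pattern outside GM's Fig. 1) closes the route. A
transfer-matrix signature of a phase transition separating the compass point from the plus point on
every D4-symmetric path of the critical surface of Γ⁺ (jump of the strip exponent away from 5/8,
collapse driven by w) refutes the mechanism of SurfaceUniversality and reduces the route to its
by-product (a new exactly solvable honest lattice: R + PortDictionary), to be closed `superseded` in
favour of SAWHexUniversality. YBSquareSLE refuted (a Θ-dependent or non-SLE limit of GM's walk)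
kills CompassSLE and SAWHexUniversality's r5 alike. SAWScalingLimit proved elsewhere moots
everything but R + PortDictionary, which stay worth landing as Literature-grade facts.

NOT DECOMPOSED YET. Everything inside CompassSLE beyond its reduction to YBSquareSLE (that is the
honeycomb programme: parafermion, tightness, identification — routes SAWHexUniversality /
SAWParafermion); the path in the critical surface of Γ⁺, the definition of that surface (divergence
of the susceptibility along rays) and the dilute-phase condition; the O(δ) coupling lemma; the
transported corollaries (criticality, two-point function, y_c) — corollaries of PortDictionary +
GM's named facts (GlazmanManolescu2019_thm1/2/3, not yet discharged in the tree; deliberately NOT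
hypotheses of any item so the route's cone stays proved); endpoint-approximation plumbing beyond
CompassEndpoints; the negative side (¬SurfaceUniversality via a collapse transition) is a kit
experiment first, not an item. CONE STATUS (route-repair 2026-08-15): needs-fact NONE — no item and
not `closes` takes an unproved Literature Prop as hypothesis (gate used-constants cone: 0 unproved
of 116 project constants, staffable); the 21 unproved closed Props in the file's IMPORT closure are
16 from the gate header import `Summits.CriticalPhenomena.Statement` / the sub Statement's own cone
(shared by every route of the summit, four of them the Literature constants behind the four
sub-problem Statements) + HexSAWScalingLimit (registered open conjecture, DCS Conj. 1 — its strength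
is carried here by the route's own cruxes CompassSLE / YBSquareSLE, never as a hypothesis) +
GlazmanManolescu2019_thm1/2/3 (corollary-only, above) + GlazmanManolescu2019_prop11 (mis-quoted in
the tree — cube missing — never to be used); the single own import
`Literature.Probability.RandomPlanarGeometry.YangBaxterSAWLaw` is minimal at module granularity
(IsYBEndpointApprox, ybLaw, meshFaces, planeCorner/planeMidpoint, YBWalk.curve live there; the
weights, Face/MidEdge/Side and YBWalk in YangBaxterSAW.lean, co-located with the four GM facts and
importing HexSAW.lean), so no route edit can shrink the import closure — only a Literature-side
facts-free core module (decl names unchanged) could, suggested to the librarian.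

CHEAPEST FALSIFIER. (i) CompassRealisation numerically then exactly: re-solve T_opp·u₁ = T_adj·v,
D·u₁² = T_adj²·w₁ at s = 1 with interval Newton (planner's plain-float re-derivation from scratch:
residuals < 1e-17, both family members of the card reproduced to 9 digits; polynomials cross-checked
by an independent brute-force enumeration — folder compute/compass_check.py,
compute/crosscheck_lean_polys.py); a certified enclosure failing to close kills the line in minutes.
(ii) PortDictionary on a 2×2 and 3×3 block of faces: enumerate all compass paths between two
boundary ports and compare fibre by fibre with brute-force YBWalks and GM weights (minutes; any
mismatch is decisive). (iii) For SurfaceUniversality: transfer-matrix strip exponents along a D4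
path of Γ⁺ (widths ≤ 8 faces): a drift of the boundary exponent from 5/8 or a jump flags a
transition.

NUMBERS. GM θ = π/2 weights (GlazmanManolescu2019 eq. (1); tree decls
weightU1/weightU2/weightV/weightW1/weightW2 at π/2): u₁ = u₂ = (√2/2)·sin(3π/16)/sin²(7π/16) =
0.408390934, v = sin²(3π/16)/sin²(7π/16) = 0.320870698, w₁ = w₂ = sin(3π/16)sin(π/16)/sin²(7π/16) =
0.112674805; gauge-free targets v/u₁ = √2 sin(3π/16) = 0.785694958, w₁/u₁² = 2
sin(π/16)cos²(π/16)/sin(3π/16) = 0.675576651. Gadget: 12 internal vertices, 22 adjacent / 24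
opposite terminal routes, 15 disjoint adjacent pairs, 0 crossing pairs; T_adj has 11 monomials
(total degree 11), T_opp 8, D 5. Solutions: (s=1) α = 0.176073479, β = 0.442080830, z = 2.286842805;
(α=β) 0.146690793, s = 2.448064821, z = 2.459167475. 4-cycle decoration: closest approach (v/u,
w/u²) = (0.7755, 0.6654) vs (0.7857, 0.6756). Growth rates: 1/u₁(π/2) = 2.4486 (Glazman 2015) vs
μ(ℤ²) ≈ 2.6382 (MadrasSlade1993); y_c = 1 + √2. Items at open: 7 (4 cruxes, 2 support, 1 assembly).

DEFINITION REQUESTS. To be filed after open (the items are typed inline with `let`s and do not wait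
for them): (D1) `edgeFugacityLaw` — the SAW law on an embedded locally finite graph with
EDGE-dependent fugacities y : Sym2 V → ℝ (generalising
`Literature.Probability.RandomPlanarGeometry.SAW.embLaw`, single vertex fugacity), topic
Literature/Probability/RandomPlanarGeometry, source GrimmettLi2019 (weighted SAW;
doi:10.1007/s10801-019-00895-6); (D2) `compassLattice` / `portGadgetLattice Δ G` — the port-gadget
graph over a set of faces of GM's tiling (`MidEdge ⊕ Face × V(G)`) with its planar embedding, and
the compass gadget as the instance used here; (D3) later, for the split of SurfaceUniversality: the
critical surface of a multi-fugacity periodic SAW (boundary of the domain of convergence of the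
susceptibility along rays). Bib: GrimmettLi2019 added this session; JensenGuttmann1998
(doi:10.1088/0305-4470/31/40/008) and GrimmettLi2013 (doi:10.37236/2659) fetched (`lit cite`) but
`ledger bib add` timed out — cited by DOI.

Novelty: Searches (2026-08-15, this planner, on top of the card's and the refuter audit's): `lit search
--hybrid "self-avoiding walk decorated lattice exact critical point Yang-Baxter integrable weights
square lattice O(n) n=0"` (15 book hits: Madras–Slade, Janse van Rensburg 2015, Guttmann (ed.)
Polygons — decorations only of the honeycomb walk (3.12²), 4-8 numerical); `lit search --source
crossref "self-avoiding walks and polygons on semi-regular lattices Jensen Guttmann"`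
(JensenGuttmann1998 doi:10.1088/0305-4470/31/40/008: semi-regular lattices, exact only for
honeycomb-derived ones); `lit search --source crossref "Grimmett Li self-avoiding walks Fisher
transformation"` (GrimmettLi2013 doi:10.37236/2659, GrimmettLi2019 doi:10.1007/s10801-019-00895-6
weighted SAW, Grimmett–Li locality — the tools for the endpoint faces of (U), none decorates GM's
model); `lit search --source zbmath "self-avoiding walk square-octagon lattice connective constant"`
(0); `lit frontier CriticalPhenomena --since 2021` (30 rows; SAW entries: quantitative
sub-ballisticity arXiv:2310.17299 only); `lit bridges CriticalPhenomena --cross any` (nothing on SAW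
decorations); `lit galaxy search … --star all` ×3 (galaxyd saturated, 0 rows returned — logged, not
relied on); arXiv API rate-limited (429). Ledger: `ledger negatives` (1 refuted statement, Tight
over all δ — every statement here is eventual/Tendsto in δ); the six route files of the sub-problem
and the 139 sibling cards' index (yang-baxter-path-coupling-r  [refs: 10.1088/0305-4470/31/40/008:, 10.37236/2659, 10.1007/s10801-019-00895-6, 10.1088/1751-8113/45/50/505003, 2310.17299, 1708.00395, 1402.5376, doi:10.1088/0305-4470/31/40/008, doi:10.37236/2659, doi:10.1007/s10801-019-00895-6, doi:10.1088/1751-8113/45/50/505003, JensenGuttmann1998, GrimmettLi2019, GlazmanManolescu2019, IkhlefCardy2009]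

Barriers (technique_class: integrable-decoration, port-gadget, critical-surface): - technique_class: integrable-decoration, port-gadget, critical-surface
- Literature.Barriers.CriticalPhenomena.NienhuisWeightsExcludeVertexSAW: EVADED, not contradicted —
the uniform ℤ² walk is untouched (no exact vertex relation is written for
`midEdgeParafermionicObservable`; `not_hasExactVertexRelationZ2` stays true); integrability is
realised by a DIFFERENT honest walk whose observable lives on the ports, three fugacity classes away
from the plus gadget; the barrier's computation ("the plus gadget misses the Nienhuis point") is
extended here to "outerplanar gadgets miss, the compass hits".
- Literature.Barriers.CriticalPhenomena.ParafermionicHalfCauchyRiemann: APPLIES verbatim to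
CompassSLE / YBSquareSLE (only the plaquette half of discrete Cauchy–Riemann on the ports); it does
not evade it; the bet is that the new content is (R) + PortDictionary + (U), and that (Σ) falls with
the honeycomb programme (routes SAWHexUniversality / SAWParafermion), to which YBSquareSLE is the
typed interface.
- Literature.Barriers.CriticalPhenomena.EmbeddingModulusUniqueness: inert by design — (U) compares
two D4-symmetric models on one embedded ℤ²-periodic lattice and the intended path keeps D4 at every
t, so no linear modulus can appear (Beffara's own evasion "an extra automorphism pins the modulus",
available all along the path, not only at the ends).
- Literature.Barriers.CriticalPhenomena.SupercriticalSAWSpaceFilling: respected — every law is taken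
AT its critical point (Γ* exactly cri

History (route lifecycle, newest last):
- 2026-08-25T14:02:29Z · DORMANT — reconciler: no traction for 7.8 d (last activity item-evidence-added at 2026-08-17T19:16:32Z); parked, not closed — `ledger route dormant route-CriticalPhenomen (operator:999:3650341)

sub-problem: SAWScalingLimit · status: dormant · opened planner-plancard-CriticalPhenomena-SAWScaling-ee14aa6f-0 2026-08-15T11:56:44Z · rev 3 · ledger route-CriticalPhenomena-SAWCompassLattice
GENERATED by the gate from the ledger (D-0016/17). Provers cite these decls: `theorem foo : Summit.CriticalPhenomena.SAWScalingLimit.Theses.SAWCompassLattice.<Decl> := …` in Summits/CriticalPhenomena/SAWScalingLimit/Theorems/<Name>.lean.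
-/

namespace Summit.CriticalPhenomena.SAWScalingLimit.Theses.SAWCompassLattice

open scoped BigOperators Topology Manifold Classical MeasureTheory ProbabilityTheory Matrix InnerProductSpace ComplexConjugate ContinuousMap
open Filter Set Function TopologicalSpace MeasureTheory

attribute [summit_statement] _root_.SAWScalingLimit

/-- item stmt-CriticalPhenomena-6964 · crux · rank 3 · open · by planner
why it might fail: 2D SAW universality is open in every instance (no two planar lattices/weightings are proved to share a scaling limit); nothing rigorous makes D4-even reweighting irrelevant at a non-Gaussian fixed point; a collapse transition on the Γ⁺ path (osculation weight w, Blöte–Nienhuis) would split them.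
sources: MadrasSlade1993, Beffara2008Universal, BloteNienhuis1989, doi:10.1088/1751-8113/45/50/505003, GlazmanManolescu2019, KennedyLawler2013
[crux] (card r2, hardest, the new mathematics) for every solution (α,β,s,z) of the compass
equations, every Dobrushin domain (Ω;a,b), every ℤ² endpoint approximation (a_δ,b_δ)
(`SAW.IsEndpointApprox`) and every port endpoint approximation (a'_δ,b'_δ) (`IsYBEndpointApprox` at
Θ ≡ π/2), and every bounded continuous f on `CurveClass ℂ`: ∫ f∘curve dP^(ℤ²)_(x_c,δ) − ∫ f
d(compass chordal law)_δ → 0 as δ → 0+. Intended mechanism (informal; the foreseen split): both laws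
are honest SAW laws on ONE lattice Γ⁺ = compass ∪ plus (ℤ² = plus gadget of fugacity √x_c on the
same ports); follow a path t ↦ y(t) in the critical surface of Γ⁺ from (α,β,s,z;0) to
(0,0,0,0;√x_c): D4 at every t (no linear modulus), D4-even scores (no spin-2 response),
locality/continuity of weighted SAW at the two orthant faces (Grimmett–Li), dilute phase throughout
(checkable by transfer matrices). [deps: CompassRealisation] [difficulty: XL] -/
@[route_item "route-CriticalPhenomena-SAWCompassLattice", crux]
def SurfaceUniversality : Prop :=
  open Literature.Probability.RandomPlanarGeometry.SAW.YangBaxter Literature.Probability.RandomPlanarGeometry in ∀ (α β s z : ℝ), (0 < α ∧ 0 < β ∧ 0 < s ∧ 0 < z ∧ z ^ 2 * (α ^ 2 + α ^ 6 + s ^ 2 * (2 * α ^ 2 * β + 2 * α ^ 2 * β ^ 2 + 2 * α ^ 2 * β ^ 3 + 2 * α ^ 4 * β + 4 * α ^ 4 * β ^ 2 + 2 * α ^ 4 * β ^ 3 + 2 * α ^ 6 * β + 2 * α ^ 6 * β ^ 3) + 2 * s ^ 4 * α ^ 4 * β ^ 2) = weightU1 (Real.pi / 2) ∧ z ^ 2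 * (2 * α ^ 4 + s ^ 2 * (2 * α ^ 2 * β + 4 * α ^ 2 * β ^ 2 + 2 * α ^ 2 * β ^ 3 + 4 * α ^ 4 * β + 4 * α ^ 4 * β ^ 3 + 4 * α ^ 6 * β ^ 2) + 2 * s ^ 4 * α ^ 4 * β ^ 2) = weightV (Real.pi / 2) ∧ z ^ 4 * (α ^ 4 + s ^ 2 * (4 * α ^ 4 * β + 4 * α ^ 4 * β ^ 2 + 4 * α ^ 4 * β ^ 3) + 2 * s ^ 4 * α ^ 4 * β ^ 2) = weightW1 (Real.pi / 2)) → let cyc : Fin 4 → Side := ![Side.W, Side.N, Side.E, Side.S]; let R : (MidEdge ⊕ Face × Fin 3 × Fin 4) → (MidEdge ⊕ Face × Fin 3 × Fin 4) → Prop := fun x x' => (match x, x' with | Sum.inl e, Sum.inr (f, (l, i)) => l = 0 ∧ f.side (cyc i) = e | Sum.inr (f, (l, i)), Sum.inr (f', (l', i')) => f = f' ∧ ((l = 0 ∧ l' = 1 ∧ (i' = i ∨ i' + 1 = i)) ∨ (l = 1 ∧ l' = 2 ∧ i' = i) ∨ (l = 2 ∧ l' = 2 ∧ i' = i + 1)) |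 _, _ => False); let G : SimpleGraph (MidEdge ⊕ Face × Fin 3 × Fin 4) := SimpleGraph.fromRel R; let y : (MidEdge ⊕ Face × Fin 3 × Fin 4) → (MidEdge ⊕ Face × Fin 3 × Fin 4) → ℝ := fun x x' => (match x, x' with | Sum.inl _, Sum.inr _ => z | Sum.inr _, Sum.inl _ => z | Sum.inr (_, (l, _)), Sum.inr (_, (l', _)) => if l = 0 ∨ l' = 0 then α else if l = 1 ∨ l' = 1 then s else β | _, _ => 0); let wt : ∀ {u v : (MidEdge ⊕ Face × Fin 3 × Fin 4)}, G.Walk u v → ℝ := fun p => (p.darts.map fun d => y d.fst d.snd).prod; let dir : Fin 4 → ℂ := ![-1, Complex.I, 1, -Complex.I]; let emb : (MidEdge ⊕ Face × Fin 3 × Fin 4) → ℂ := fun x => (match x with | Sum.inl e => planeMidpoint (fun (_ : ℤ) => Real.pi / 2) e | Sum.inr (f, (l, i)) => planeCorner (fun (_ : ℤ) => Real.pi / 2) f + (1 + Complex.I) / 2 + (if l = 0 then (3 / 8 : ℂ) * dir i else (if l = 1 then (1 / 4 : ℂ) else (1 / 8 : ℂ)) * (dir i + dir (i + 1)))); let S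 : Set ℂ → ℝ → Set (MidEdge ⊕ Face × Fin 3 × Fin 4) := fun Ω δ => {v | ∀ f q, v = Sum.inr (f, q) → f ∈ meshFaces (fun (_ : ℤ) => Real.pi / 2) Ω δ}; let μ : Set ℂ → ℝ → MidEdge → MidEdge → Measure (CurveClass ℂ) := fun Ω δ a b => Measure.sum (fun p : {p : G.Walk (Sum.inl a) (Sum.inl b) // p.IsPath ∧ ∀ v ∈ p.support, v ∈ S Ω δ} => ENNReal.ofReal (wt p.1) • Measure.dirac (CurveClass.mk ⟨p.1.toCurve fun v => (δ : ℂ) * emb v⟩)); let law : Set ℂ → ℝ → MidEdge → MidEdge → Measure (CurveClass ℂ) := fun Ω δ a b => (μ Ω δ a b Set.univ)⁻¹ • μ Ω δ a b; ∀ (D : DobrushinDomain) (a b : ℝ → Literature.Probability.LatticeModels.Site 2) (a' b' : ℝ → MidEdge), SAW.IsEndpointApprox D a b → IsYBEndpointApprox (fun (_ : ℤ) => Real.pi / 2) D a' b' → ∀ f : BoundedContinuousFunction (CurveClass ℂ) ℝ, Filter.Tendsto (fun δ => (∫ γ, f γ.curve ∂(SAW.law D.carrier δ (a δ) (b δ)))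 - ∫ x, f x ∂(law D.carrier δ (a' δ) (b' δ))) (nhdsWithin 0 (Set.Ioi 0)) (nhds 0)

/-- item stmt-CriticalPhenomena-6965 · crux · rank 4 · open · by planner
why it might fail: via PortDictionary + O(δ) coupling it IS SLE(8/3) convergence of GM's θ=π/2 face-walk (Duminil-Copin–Smirnov Conj. 1 transported): the port parafermion obeys only the plaquette half of discrete Cauchy–Riemann (ParafermionicHalfCauchyRiemann_holds), no SAW tightness/RSW exists, D4 adds no relation.
sources: DuminilCopinSmirnov2012, LawlerSchrammWerner2004SAW, GlazmanManolescu2019, Literature.Barriers.CriticalPhenomena.ParafermionicHalfCauchyRiemann, DuminilCopin2013Parafermion, IkhlefCardy2009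
[crux] (card r3) for every solution (α,β,s,z), every Dobrushin domain and every port endpoint
approximation (`IsYBEndpointApprox` at Θ ≡ π/2), the compass chordal law — edge-fugacity
self-avoiding paths of the compass graph on `MidEdge ⊕ (Face × (Fin 3 × Fin 4))` from port a_δ to
port b_δ using only gadgets of faces in `meshFaces (π/2) Ω δ`, weight = product of edge fugacities
(α outer cycle, β inner cycle, s spokes, z port–terminal), normalised, pushed to `CurveClass ℂ` by
the δ-scaled polyline through the embedded vertices — converges in law to chordal SLE_(8/3)
(`ConvergesInLawToSLE (8/3)`). Via PortDictionary and the deterministic O(δ) coupling (each gadget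
lies inside its face) this is exactly support item YBSquareSLE, i.e. Duminil-Copin–Smirnov
Conjecture 1 transported to GM's θ = π/2 walk — same status as on the honeycomb lattice, but on a
lattice sharing ℤ²'s axes, reflections and quarter-turn, where the spin-5/8 parafermion lives on the
ports. [deps: CompassRealisation, PortDictionary, YBSquareSLE] [difficulty: open-problem] -/
@[route_item "route-CriticalPhenomena-SAWCompassLattice", crux]
def CompassSLE : Prop :=
  open Literature.Probability.RandomPlanarGeometry.SAW.YangBaxter Literature.Probability.RandomPlanarGeometry in ∀ (α β s z : ℝ), (0 < α ∧ 0 < β ∧ 0 < s ∧ 0 < z ∧ z ^ 2 * (α ^ 2 + α ^ 6 + s ^ 2 * (2 * α ^ 2 * β + 2 * α ^ 2 * β ^ 2 + 2 * α ^ 2 * β ^ 3 + 2 * α ^ 4 * β + 4 * α ^ 4 * β ^ 2 + 2 * α ^ 4 * β ^ 3 + 2 * α ^ 6 * β + 2 * α ^ 6 * β ^ 3) + 2 * s ^ 4 * α ^ 4 * β ^ 2) = weightU1 (Real.pi / 2) ∧ z ^ 2 * (2 * α ^ 4 + s ^ 2 * (2 * α ^ 2 * β + 4 * α ^ 2 *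 β ^ 2 + 2 * α ^ 2 * β ^ 3 + 4 * α ^ 4 * β + 4 * α ^ 4 * β ^ 3 + 4 * α ^ 6 * β ^ 2) + 2 * s ^ 4 * α ^ 4 * β ^ 2) = weightV (Real.pi / 2) ∧ z ^ 4 * (α ^ 4 + s ^ 2 * (4 * α ^ 4 * β + 4 * α ^ 4 * β ^ 2 + 4 * α ^ 4 * β ^ 3) + 2 * s ^ 4 * α ^ 4 * β ^ 2) = weightW1 (Real.pi / 2)) → let cyc : Fin 4 → Side := ![Side.W, Side.N, Side.E, Side.S]; let R : (MidEdge ⊕ Face × Fin 3 × Fin 4) → (MidEdge ⊕ Face × Fin 3 × Fin 4) → Prop := fun x x' => (match x, x' with | Sum.inl e, Sum.inr (f, (l, i)) => l = 0 ∧ f.side (cyc i) = e | Sum.inr (f, (l, i)), Sum.inr (f', (l', i')) => f = f' ∧ ((l = 0 ∧ l' = 1 ∧ (i' = i ∨ i' + 1 = i)) ∨ (l = 1 ∧ l' = 2 ∧ i' = i) ∨ (l = 2 ∧ l' = 2 ∧ i' = i + 1)) | _, _ => False); let G : SimpleGraph (MidEdge ⊕ Face × Fin 3 × Fin 4) :=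 SimpleGraph.fromRel R; let y : (MidEdge ⊕ Face × Fin 3 × Fin 4) → (MidEdge ⊕ Face × Fin 3 × Fin 4) → ℝ := fun x x' => (match x, x' with | Sum.inl _, Sum.inr _ => z | Sum.inr _, Sum.inl _ => z | Sum.inr (_, (l, _)), Sum.inr (_, (l', _)) => if l = 0 ∨ l' = 0 then α else if l = 1 ∨ l' = 1 then s else β | _, _ => 0); let wt : ∀ {u v : (MidEdge ⊕ Face × Fin 3 × Fin 4)}, G.Walk u v → ℝ := fun p => (p.darts.map fun d => y d.fst d.snd).prod; let dir : Fin 4 → ℂ := ![-1, Complex.I, 1, -Complex.I]; let emb : (MidEdge ⊕ Face × Fin 3 × Fin 4) → ℂ := fun x => (match x with | Sum.inl e => planeMidpoint (fun (_ : ℤ) => Real.pi / 2) e | Sum.inr (f, (l, i)) => planeCorner (fun (_ : ℤ) => Real.pi / 2) f + (1 + Complex.I) / 2 + (if l = 0 then (3 / 8 : ℂ) * dir i else (if l = 1 then (1 / 4 : ℂ) else (1 / 8 : ℂ)) * (dir i + dir (i + 1)))); let S : Set ℂ → ℝ → Set (MidEdge ⊕ Face × Fin 3 × Fin 4) := fun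 Ω δ => {v | ∀ f q, v = Sum.inr (f, q) → f ∈ meshFaces (fun (_ : ℤ) => Real.pi / 2) Ω δ}; let μ : Set ℂ → ℝ → MidEdge → MidEdge → Measure (CurveClass ℂ) := fun Ω δ a b => Measure.sum (fun p : {p : G.Walk (Sum.inl a) (Sum.inl b) // p.IsPath ∧ ∀ v ∈ p.support, v ∈ S Ω δ} => ENNReal.ofReal (wt p.1) • Measure.dirac (CurveClass.mk ⟨p.1.toCurve fun v => (δ : ℂ) * emb v⟩)); let law : Set ℂ → ℝ → MidEdge → MidEdge → Measure (CurveClass ℂ) := fun Ω δ a b => (μ Ω δ a b Set.univ)⁻¹ • μ Ω δ a b; ∀ (D : DobrushinDomain) (a b : ℝ → MidEdge), IsYBEndpointApprox (fun (_ : ℤ) => Real.pi / 2) D a b → ConvergesInLawToSLE ((8 : NNReal) / 3) D (fun (_ : ℝ) (x : CurveClass ℂ) => x) (fun δ => law D.carrier δ (a δ) (b δ))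

/-- item stmt-CriticalPhenomena-6967 · crux · rank 9 · open · by planner
why it might fail: Duminil-Copin–Smirnov Conj. 1 moved to θ=π/2: GM's Yang–Baxter moves preserve partition functions (Thms 1–2), not curve laws, so even HexSAWScalingLimit does not give it without a law-level transport; SLE(8/3) convergence is open on every lattice (half Cauchy–Riemann, no tightness).
sources: GlazmanManolescu2019, DuminilCopinSmirnov2012, LawlerSchrammWerner2004SAW, Literature.Barriers.CriticalPhenomena.ParafermionicHalfCauchyRiemann
[support] Glazman–Manolescu's critical Yang–Baxter walk on the square tiling (Θ ≡ π/2, fugacity x =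
1: `ybLaw`, curve `YBWalk.curve`) converges to chordal SLE_(8/3) in every Dobrushin domain with port
endpoint approximations — the clean interface with route SAWHexUniversality (its HexConjecture +
YBUniversalityOfLimit at Θ ≡ π/3 ↔ π/2 give it) and the parent of the foreseen split CompassSLE ⇐
YBSquareSLE + PortDictionary-coupling. [difficulty: open-problem] -/
@[route_item "route-CriticalPhenomena-SAWCompassLattice", crux]
def YBSquareSLE : Prop :=
  open Literature.Probability.RandomPlanarGeometry.SAW.YangBaxter Literature.Probability.RandomPlanarGeometry in ∀ (D : DobrushinDomain) (a b : ℝ → MidEdge), IsYBEndpointApprox (fun (_ : ℤ) => Real.pi / 2) D a b → ConvergesInLawToSLE ((8 : NNReal) / 3) D (fun δ (γ : YangBaxterSAW (fun (_ : ℤ) => Real.pi / 2) D.carrier δ (a δ) (b δ)) => γ.curve (fun (_ : ℤ) => Real.pi / 2) δ) (fun δ => ybLaw (fun (_ : ℤ) => Real.pi / 2) D.carrier δ 1 (a δ) (b δ))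

/-- item stmt-CriticalPhenomena-6963 · support · rank 2 · closed · proved by Summit.CriticalPhenomena.SAWScalingLimit.Cruxes.HexTransfer.Sketch.stub_compassRealisation (prover) · by planner
why it might fail: the exact positive solution is certified only in floating point (Newton at two family members); an ill-conditioned or spurious root, or a solution family leaving the positive orthant, kills Γ* — the plain 4-cycle decoration provably misses the target by 1.5 %.
sources: GlazmanManolescu2019, Glazman2015WeightedSAW, Literature.Barriers.CriticalPhenomena.weightU1_pi_div_two
[crux] (card r4, the construction; ranked first as the gating fact of the mechanism, plancard rule)
there exist reals α, β, s, z > 0 with z²·T_adj(α,β,s) = weightU1(π/2), z²·T_opp(α,β,s) =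
weightV(π/2) and z⁴·D(α,β,s) = weightW1(π/2), where T_adj / T_opp are the generating polynomials of
the 22 / 24 simple routes between adjacent / opposite terminals of the compass gadget (routes
through the other terminals included) and D that of the 15 vertex-disjoint pairs of adjacent routes
— the explicit integer polynomials written in the Lean term (α enters only through α², s only
through s², and T_adj, T_opp are quadratic in s² with the SAME top coefficient 2α⁴β², so T_opp·u₁ =
T_adj·v is solvable for s² in radicals and one 1-D intermediate-value argument in α at fixed β
finishes; numerically s = 1: α = 0.176073479, β = 0.442080830, z = 2.286842805; α = β = 0.146690793:
s = 2.448064821, z = 2.459167475). [difficulty: provable-now] -/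
@[route_item "route-CriticalPhenomena-SAWCompassLattice", crux]
def CompassRealisation : Prop :=
  open Literature.Probability.RandomPlanarGeometry.SAW.YangBaxter Literature.Probability.RandomPlanarGeometry in ∃ α β s z : ℝ, (0 < α ∧ 0 < β ∧ 0 < s ∧ 0 < z ∧ z ^ 2 * (α ^ 2 + α ^ 6 + s ^ 2 * (2 * α ^ 2 * β + 2 * α ^ 2 * β ^ 2 + 2 * α ^ 2 * β ^ 3 + 2 * α ^ 4 * β + 4 * α ^ 4 * β ^ 2 + 2 * α ^ 4 * β ^ 3 + 2 * α ^ 6 * β + 2 * α ^ 6 * β ^ 3) + 2 * s ^ 4 * α ^ 4 * β ^ 2) = weightU1 (Real.pi / 2) ∧ z ^ 2 * (2 * α ^ 4 + s ^ 2 * (2 * α ^ 2 * β + 4 * α ^ 2 * β ^ 2 + 2 * α ^ 2 * β ^ 3 + 4 * α ^ 4 * β + 4 * α ^ 4 * β ^ 3 + 4 * α ^ 6 * β ^ 2) + 2 * s ^ 4 * α ^ 4 * β ^ 2) = weightV (Real.pi / 2) ∧ z ^ 4 * (α ^ 4 + s ^ 2 * (4 * α ^ 4 * β + 4 * α ^ 4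 * β ^ 2 + 4 * α ^ 4 * β ^ 3) + 2 * s ^ 4 * α ^ 4 * β ^ 2) = weightW1 (Real.pi / 2))

/-- item stmt-CriticalPhenomena-6966 · support · rank 5 · closed · proved by Summit.CriticalPhenomena.SAWScalingLimit.Cruxes.HexTransfer.Sketch.stub_portDictionary (prover) · by planner
why it might fail: a bookkeeping mismatch with the tree's `YBWalk` conventions (boundary mid-edges whose outer face is not in Δ, `kindsIn` order, `arcFace` of repeated faces) or an internal route class missed in T_adj/T_opp/D would falsify the identity exactly as typed (repairable by restating).
sources: GlazmanManolescu2019, Literature.Probability.RandomPlanarGeometry.SAW.YangBaxter.YBWalk, Literature.Barriers.CriticalPhenomena.weightU1_eq_weightU2_pi_div_two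
[crux] (card r4, the dictionary; provable core) for every solution (α,β,s,z), every set of faces Δ,
ports a, b and every list ms of mid-edges: the total weight of the compass self-avoiding paths from
port a to port b that use only gadgets of faces in Δ and whose ordered sequence of visited ports is
ms EQUALS the Glazman–Manolescu weight w_(π/2)(γ) of the Yang–Baxter walk γ of Δ with `mids = ms`
(both sides 0 if there is none). Content: degree-2 ports ⇒ each edge crossed at most once and
consecutive passages lie in different faces (`isChain`); ≤ 2 vertex-disjoint passages per face; the
crossing pairing {W,E}+{S,N} has no realisation in the planar gadget (`noncross`; 0 pairs by
enumeration); summing internal routes face by face gives face weights (1, z²T_adj, z²T_opp, z⁴D) =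
(1, u₁, v, w₁)(π/2), and u₂(π/2) = u₁(π/2), w₂(π/2) = w₁(π/2) (proved in
NienhuisWeightsExcludeVertexSAW). Corollaries by transport, not filed as items: compass port-to-port
partition functions = `twoPoint Δ (π/2)`, hence exact criticality (Glazman 2015 Thm 1.1),
honeycomb-equal half-plane two-point function and B_T → 0 (GM Thms 1–2), y_c = 1+√2 (GM Thm 3).
[difficulty: provable-now] -/
@[route_item "route-CriticalPhenomena-SAWCompassLattice"]
def PortDictionary : Prop :=
  open Literature.Probability.RandomPlanarGeometry.SAW.YangBaxter Literature.Probability.RandomPlanarGeometry in ∀ (α β s z : ℝ), (0 < α ∧ 0 < β ∧ 0 < s ∧ 0 < z ∧ z ^ 2 * (α ^ 2 + α ^ 6 + s ^ 2 * (2 * α ^ 2 * β + 2 * α ^ 2 * β ^ 2 + 2 * α ^ 2 * β ^ 3 + 2 * α ^ 4 * β + 4 * α ^ 4 * β ^ 2 + 2 * α ^ 4 * β ^ 3 + 2 * α ^ 6 * β + 2 * α ^ 6 * β ^ 3) + 2 * s ^ 4 * α ^ 4 * β ^ 2) = weightU1 (Real.pi / 2) ∧ z ^ 2 * (2 * α ^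 4 + s ^ 2 * (2 * α ^ 2 * β + 4 * α ^ 2 * β ^ 2 + 2 * α ^ 2 * β ^ 3 + 4 * α ^ 4 * β + 4 * α ^ 4 * β ^ 3 + 4 * α ^ 6 * β ^ 2) + 2 * s ^ 4 * α ^ 4 * β ^ 2) = weightV (Real.pi / 2) ∧ z ^ 4 * (α ^ 4 + s ^ 2 * (4 * α ^ 4 * β + 4 * α ^ 4 * β ^ 2 + 4 * α ^ 4 * β ^ 3) + 2 * s ^ 4 * α ^ 4 * β ^ 2) = weightW1 (Real.pi / 2)) → let cyc : Fin 4 → Side := ![Side.W, Side.N, Side.E, Side.S]; let R : (MidEdge ⊕ Face × Fin 3 × Fin 4) → (MidEdge ⊕ Face × Fin 3 × Fin 4) → Prop := fun x x' => (match x, x' with | Sum.inl e, Sum.inr (f, (l, i)) => l = 0 ∧ f.side (cyc i) = e | Sum.inr (f, (l, i)), Sum.inr (f', (l', i')) => f = f' ∧ ((l = 0 ∧ l' = 1 ∧ (i' = i ∨ i' + 1 = i)) ∨ (l = 1 ∧ l' = 2 ∧ i' = i) ∨ (l = 2 ∧ l' = 2 ∧ i' = i + 1)) | _, _ => False); let G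 : SimpleGraph (MidEdge ⊕ Face × Fin 3 × Fin 4) := SimpleGraph.fromRel R; let y : (MidEdge ⊕ Face × Fin 3 × Fin 4) → (MidEdge ⊕ Face × Fin 3 × Fin 4) → ℝ := fun x x' => (match x, x' with | Sum.inl _, Sum.inr _ => z | Sum.inr _, Sum.inl _ => z | Sum.inr (_, (l, _)), Sum.inr (_, (l', _)) => if l = 0 ∨ l' = 0 then α else if l = 1 ∨ l' = 1 then s else β | _, _ => 0); let wt : ∀ {u v : (MidEdge ⊕ Face × Fin 3 × Fin 4)}, G.Walk u v → ℝ := fun p => (p.darts.map fun d => y d.fst d.snd).prod; ∀ (Δ : Set Face) (a b : MidEdge) (ms : List MidEdge), (∑' p : {p : G.Walk (Sum.inl a) (Sum.inl b) // p.IsPath ∧ (∀ v ∈ p.support, ∀ f q, v = Sum.inr (f, q) → f ∈ Δ) ∧ p.support.filterMap Sum.getLeft? = ms}, ENNReal.ofReal (wt p.1)) = ∑' γ : {γ : YBWalk Δ a b // γ.mids = ms}, ENNReal.ofReal (γ.1.weight (fun (_ : ℤ) => Real.pi / 2))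

/-- item stmt-CriticalPhenomena-6968 · support · rank 9 · closed · proved by Summit.CriticalPhenomena.SAWScalingLimit.Cruxes.HexTransfer.Sketch.stub_compassEndpoints (prover) · by planner
sources: DuminilCopinSmirnov2012, GlazmanManolescu2019
[support] every Dobrushin domain (bounded Jordan domain, two marked prime ends) admits port endpoint
approximations at Θ ≡ π/2: mid-edges a_δ, b_δ joined by a Yang–Baxter walk through faces of
`meshFaces (π/2) Ω δ`, with δ·a_δ → a and δ·b_δ → b (accessibility of boundary points of a Jordan
domain + a chain of δ-faces along an interior path; diagonal choice in δ). Needed only to make the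
Assembly pure logic. [difficulty: provable-now] -/
@[route_item "route-CriticalPhenomena-SAWCompassLattice", crux]
def CompassEndpoints : Prop :=
  open Literature.Probability.RandomPlanarGeometry.SAW.YangBaxter Literature.Probability.RandomPlanarGeometry in ∀ D : DobrushinDomain, ∃ a b : ℝ → MidEdge, IsYBEndpointApprox (fun (_ : ℤ) => Real.pi / 2) D a b

/-- item stmt-CriticalPhenomena-6969 · assembly · rank 1 · closed · proved by Summit.CriticalPhenomena.SAWScalingLimit.Theorems.sawCompassLattice_assembly_proof @ df3faa7aaeed (prover) · by planner
sources: LawlerSchrammWerner2004SAW, DuminilCopinSmirnov2012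
[assembly] CompassRealisation → CompassEndpoints → CompassSLE → SurfaceUniversality →
SAWScalingLimit (the sub-problem constant `SAWScalingLimit` of
Summits/CriticalPhenomena/SAWScalingLimit/Statement.lean). -/
@[route_item "route-CriticalPhenomena-SAWCompassLattice"]
def Assembly : Prop :=
  CompassRealisation → CompassEndpoints → CompassSLE → SurfaceUniversality → SAWScalingLimit

/-! D-0027 §2.1 — DECIDING THEOREM (planner-authored via `route open/edit --closes-file`; by planner-rbadge-CriticalPhenomena-SAWCompassLat-66e88787-g2-0 2026-08-15T16:21:39Z):
its hypotheses are this route's items and its conclusion the sub-problem Statement (glue_lint), and it elaborates with this file. -/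

@[closes "route-CriticalPhenomena-SAWCompassLattice"] theorem closes (hR : CompassRealisation) (hE : CompassEndpoints) (hS : CompassSLE)
    (hU : SurfaceUniversality) : _root_.SAWScalingLimit := by
  intro D a b hab
  -- a solution (α, β, s, z) of the compass equations and port endpoint approximations (a', b') of D
  obtain ⟨α, β, s, z, hsol⟩ := hR
  obtain ⟨a', b', hab'⟩ := hE D
  -- the compass chordal law from a'_δ to b'_δ converges to an SLE(8/3) random curve Γ
  obtain ⟨Γ, hΓ, -, hT⟩ := hS α β s z hsol D a' b' hab'
  refine ⟨Γ, hΓ, Filter.Eventually.of_forall fun δ =>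
    Literature.Probability.RandomPlanarGeometry.SAW.aemeasurable_curve D.carrier δ (a δ) (b δ),
    fun f => ?_⟩
  -- two-ε: (∫ f dP^{ℤ²}_δ − ∫ f d(compass law)_δ) → 0 and ∫ f d(compass law)_δ → E f(Γ)
  have h1 := hU α β s z hsol D a b a' b' hab hab' f
  have h3 := h1.add (hT f)
  rw [zero_add] at h3
  refine h3.congr fun δ => ?_
  exact sub_add_cancel _ _

end Summit.CriticalPhenomena.SAWScalingLimit.Theses.SAWCompassLattice
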